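import Mathlib.LinearAlgebra.Dual.Lemmas
import Mathlib.Analysis.Calculus.Deriv.Mul
import Mathlib.Analysis.Calculus.Deriv.ZPow
import Mathlib.Analysis.Calculus.Deriv.Comp
import Literature.Analysis.Matrix.DetExp
import Literature.NumberTheory.Automorphic.GKModuleOfDifferentiableRep
import Literature.NumberTheory.Automorphic.GKSubquotient
import HarnessLib

/-!
# Invariant subspaces, quotients, character twists of differentiable representations; `det^m`

Topic `NumberTheory/Automorphic`; namespace `Literature.NumberTheory.Automorphic.RealMatrixGroup`.
Definitions with bodies and theorems; no named fact, no `sorry`.  Companion of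
`GKModuleOfDifferentiableRep` (`IsDifferentiableRep`) and `GKSubquotient` (`GKSubmodule.subLie`,
`quotLie`).

For a linear real group `G ≤ GL(N, A)` and a differentiable representation `(τ, dτ)` of `G` on a
complex vector space `E` (`IsDifferentiableRep`: continuous matrix coefficients with derivative
`dτ` along the one-parameter subgroups):

* `IsDifferentiableRep.le_comap_of_stable` — **a `G`-stable subspace `U` is `dτ(𝔤)`-stable**
  (for `φ` in the annihilator of `U`, `t ↦ φ(τ(exp tX) u) ≡ 0`, so `φ(dτ(X) u) = 0`, and `U`
  is its double annihilator); `IsDifferentiableRep.subrepresentation`,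
  `IsDifferentiableRep.quotient` — **`U` and `E / U` are differentiable representations**
  [cite: BorelWallach2000, 0 §2.3];
* `charRep G c`, `charLie G dc` — a character `c : G →* ℂ` and an infinitesimal character
  `dc : 𝔤 →ₗ⁅ℝ⁆ ℂ` as one-dimensional data; `twist G τ c : g ↦ c(g) τ(g)` and its differential
  `twistLie G dτ dc : X ↦ dτ(X) + dc(X)·1` (a Lie morphism since `dc` kills brackets);
  `IsDifferentiableRep.twist` — **the twist of a differentiable representation by a
  differentiable character is differentiable** (product rule);
* `detChar G φ m : G →* ℂ`, `g ↦ det(φ(g))^m` for a real algebra morphism `φ : A → ℂ` and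
  `m ∈ ℤ`, `detCharLie G φ m : X ↦ m · tr(φ(X))`, and `isDifferentiableRep_detChar` — **it is a
  differentiable character** (`det(φ(exp tX)) = φ(det(exp tX))`, Jacobi's formula
  `d/dt det(exp tX)|₀ = tr X` from `Literature.Analysis.Matrix.DetExp`, and `d/dw w^m|₁ = m`).

These are the operations by which the algebraic coefficient systems of the cohomology of
arithmetic groups — Weyl modules inside tensor powers of the standard representation, twisted by
powers of the determinant (`GLnCohomology.coeffRepGL = detTwist _ (weylRepCoeff _)`) — become
`(𝔤, K∞)`-modules (`IsDifferentiableRep.isGKModule`).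

## Mathlib / Literature search

`Subspace.forall_mem_dualAnnihilator_apply_eq_zero_iff`, `Subspace.dualRestrict_surjective`,
`Representation.subrepresentation`/`quotient`, `Matrix.GeneralLinearGroup.det`/`map`,
`zpowGroupHom`, `hasDerivAt_zpow`, `HasDerivAt.comp`, `AddMonoidHom.map_trace`, `AlgHom.map_det`
(Mathlib); `hasDerivAt_det_exp_smul_zero` (tree, `Literature.Analysis.Matrix.DetExp`).

## References

* A. Borel, N. Wallach (2000), 0 §2.3–2.5 (held) [BorelWallach2000].
* A. W. Knapp, D. A. Vogan (1995), §I.4, §II.3 (held) [KnappVogan1995].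
-/

noncomputable section

namespace Literature.NumberTheory.Automorphic

open Module

-- Mathlib idiom (as in `GKModules`): commutator bracket on `Module.End`
attribute [local instance 100] LieRing.ofAssociativeRing

open scoped MatrixGroups

variable {A : Type*} [NormedCommRing A] [NormedAlgebra ℝ A] [NormedAlgebra ℚ A] [CompleteSpace A]
  [StarRing A] {N : Type*} [Fintype N] [DecidableEq N] (G : RealMatrixGroup A N)
  {E : Type*} [AddCommGroup E] [Module ℂ E]
  (τ : Representation ℂ G.carrier E) (dτ : G.lie →ₗ⁅ℝ⁆ Module.End ℂ E)

namespace RealMatrixGroup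

namespace IsDifferentiableRep

variable {G τ dτ}

/-! #### Invariant subspaces -/

/-- **A `G`-stable subspace of a differentiable representation is stable under the
differential**: for `u ∈ U` and `φ` vanishing on `U`, `t ↦ φ (τ(exp tX) u)` vanishes identically,
so its derivative `φ (dτ X u)` vanishes, and `U = U^{⊥⊥}`. [cite: BorelWallach2000, 0 §2.3] -/
theorem le_comap_of_stable (h : IsDifferentiableRep G τ dτ) {U : Submodule ℂ E}
    (hU : ∀ g : G.carrier, U ≤ U.comap (τ g)) (X : G.lie) : U ≤ U.comap (dτ X) := by
  intro u hu
  rw [Submodule.mem_comap, ← Subspace.forall_mem_dualAnnihilator_apply_eq_zero_iff]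
  intro φ hφ
  have h0 : HasDerivAt (fun t : ℝ ↦ φ (τ (G.expMem (t • X)) u)) (φ (dτ X u)) 0 :=
    h.hasDerivAt_coeff X u φ
  have hconst : (fun t : ℝ ↦ φ (τ (G.expMem (t • X)) u)) = fun _ => 0 := by
    funext t
    exact (Submodule.mem_dualAnnihilator φ).mp hφ _ (hU _ hu)
  rw [hconst] at h0
  exact h0.unique (hasDerivAt_const 0 0) ▸ rfl

/-- **A `G`-stable subspace of a differentiable representation is a differentiable
representation** (Mathlib's `Representation.subrepresentation`, the tree's
`GKSubmodule.subLie`): functionals on `U` extend to `E`. [cite: BorelWallach2000, 0 §2.3] -/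
theorem subrepresentation (h : IsDifferentiableRep G τ dτ) {U : Submodule ℂ E}
    (hU : ∀ g : G.carrier, U ≤ U.comap (τ g)) :
    IsDifferentiableRep G (τ.subrepresentation U hU)
      (GKSubmodule.subLie G dτ U (h.le_comap_of_stable hU)) where
  continuous_coeff u ℓ := by
    obtain ⟨ℓ', hℓ'⟩ := Subspace.dualRestrict_surjective (W := U) ℓ
    have key : (fun g : G.carrier ↦ ℓ (τ.subrepresentation U hU g u)) = fun g ↦ ℓ' (τ g u) := by
      funext g
      rw [← hℓ', Submodule.dualRestrict_apply]
      rfl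
    rw [key]
    exact h.continuous_coeff u ℓ'
  hasDerivAt_coeff X u ℓ := by
    obtain ⟨ℓ', hℓ'⟩ := Subspace.dualRestrict_surjective (W := U) ℓ
    have key : (fun t : ℝ ↦ ℓ (τ.subrepresentation U hU (G.expMem (t • X)) u)) =
        fun t ↦ ℓ' (τ (G.expMem (t • X)) u) := by
      funext t
      rw [← hℓ', Submodule.dualRestrict_apply]
      rfl
    have key₂ : ℓ (GKSubmodule.subLie G dτ U (h.le_comap_of_stable hU) X u) = ℓ' (dτ X u) := by
      rw [← hℓ', Submodule.dualRestrict_apply]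
      rfl
    rw [key, key₂]
    exact h.hasDerivAt_coeff X u ℓ'

/-- **The quotient of a differentiable representation by a `G`-stable subspace is
differentiable** (`Representation.quotient`, `GKSubmodule.quotLie`): functionals pull back.
[cite: BorelWallach2000, 0 §2.3] -/
theorem quotient (h : IsDifferentiableRep G τ dτ) {U : Submodule ℂ E}
    (hU : ∀ g : G.carrier, U ≤ U.comap (τ g)) :
    IsDifferentiableRep G (τ.quotient U hU)
      (GKSubmodule.quotLie G dτ U (h.le_comap_of_stable hU)) where
  continuous_coeff x ℓ := by
    obtain ⟨v, rfl⟩ := Submodule.Quotient.mk_surjective U x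
    exact h.continuous_coeff v (ℓ ∘ₗ U.mkQ)
  hasDerivAt_coeff X x ℓ := by
    obtain ⟨v, rfl⟩ := Submodule.Quotient.mk_surjective U x
    exact h.hasDerivAt_coeff X v (ℓ ∘ₗ U.mkQ)

end IsDifferentiableRep

/-! #### Characters and twists -/

omit [NormedAlgebra ℝ A] [NormedAlgebra ℚ A] [CompleteSpace A] [StarRing A] in
/-- A multiplicative character `c : G → ℂ` as a one-dimensional representation. [folklore] -/
def charRep (c : G.carrier →* ℂ) : Representation ℂ G.carrier ℂ :=
  (Algebra.lmul ℂ ℂ).toMonoidHom.comp c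

/-- Unfolding. [folklore] -/
@[simp] theorem charRep_apply (c : G.carrier →* ℂ) (g : G.carrier) (z : ℂ) :
    charRep G c g z = c g * z := rfl

/-- A real-linear infinitesimal character `dc : 𝔤 → ℂ` as a one-dimensional differential.
[folklore] -/
def charLie (dc : G.lie →ₗ⁅ℝ⁆ ℂ) : G.lie →ₗ⁅ℝ⁆ Module.End ℂ ℂ :=
  ((Algebra.lmul ℂ ℂ : ℂ →ₐ[ℂ] Module.End ℂ ℂ).restrictScalars ℝ).toLieHom.comp dc

/-- Unfolding. [folklore] -/
@[simp] theorem charLie_apply (dc : G.lie →ₗ⁅ℝ⁆ ℂ) (X : G.lie) (z : ℂ) :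
    charLie G dc X z = dc X * z := rfl

/-- **The twist `g ↦ c(g) τ(g)` of a representation by a character.**
[cite: KnappVogan1995, §II.3 (2.38)] -/
def twist (c : G.carrier →* ℂ) : Representation ℂ G.carrier E where
  toFun g := c g • τ g
  map_one' := by rw [map_one, map_one, one_smul]
  map_mul' g g' := by
    refine LinearMap.ext fun v => ?_
    simp only [map_mul, LinearMap.smul_apply, Module.End.mul_apply, map_smul, smul_smul,
      mul_comm (c g') (c g)]

/-- Unfolding. [folklore] -/
@[simp] theorem twist_apply (c : G.carrier →* ℂ) (g : G.carrier) (v : E) :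
    twist G τ c g v = c g • τ g v := rfl

/-- The differential `X ↦ dτ(X) + dc(X) · 1` of the twist. [cite: KnappVogan1995, §II.3 (2.38)] -/
def twistLie (dc : G.lie →ₗ⁅ℝ⁆ ℂ) : G.lie →ₗ⁅ℝ⁆ Module.End ℂ E where
  toFun X := dτ X + dc X • (1 : Module.End ℂ E)
  map_add' X Y := by
    rw [map_add, map_add, add_smul]
    abel
  map_smul' t X := by
    rw [map_smul, map_smul, RingHom.id_apply, smul_add]
    congr 1
    rw [Complex.real_smul, ← smul_smul]
    rfl
  map_lie' {X Y} := by
    have hdc : dc ⁅X, Y⁆ = 0 := by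
      rw [LieHom.map_lie, LieRing.of_associative_ring_bracket, mul_comm, sub_self]
    refine LinearMap.ext fun v => ?_
    simp only [hdc, zero_smul, add_zero, LieHom.map_lie, LieRing.of_associative_ring_bracket,
      LinearMap.sub_apply, LinearMap.add_apply, Module.End.mul_apply, LinearMap.smul_apply,
      Module.End.one_apply, map_add, map_smul, smul_add, smul_smul, mul_comm (dc Y) (dc X)]
    abel

/-- Unfolding. [folklore] -/
@[simp] theorem twistLie_apply (dc : G.lie →ₗ⁅ℝ⁆ ℂ) (X : G.lie) (v : E) :
    twistLie G dτ dc X v = dτ X v + dc X • v := rfl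

namespace IsDifferentiableRep

variable {G τ dτ}

/-- **The twist of a differentiable representation by a differentiable character is
differentiable** (product rule). [cite: BorelWallach2000, 0 §2.3] -/
theorem twist (h : IsDifferentiableRep G τ dτ) {c : G.carrier →* ℂ} {dc : G.lie →ₗ⁅ℝ⁆ ℂ}
    (hc : IsDifferentiableRep G (charRep G c) (charLie G dc)) :
    IsDifferentiableRep G (RealMatrixGroup.twist G τ c) (twistLie G dτ dc) where
  continuous_coeff v ℓ := by
    have hc1 := hc.continuous_coeff 1 LinearMap.id
    simp only [charRep_apply, mul_one, LinearMap.id_coe, id_eq] at hc1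
    have e : (fun g : G.carrier ↦ ℓ (RealMatrixGroup.twist G τ c g v)) =
        fun g ↦ c g * ℓ (τ g v) := by
      funext g
      rw [twist_apply, map_smul, smul_eq_mul]
    rw [e]
    exact hc1.mul (h.continuous_coeff v ℓ)
  hasDerivAt_coeff X v ℓ := by
    have hc1 := hc.hasDerivAt_coeff X 1 LinearMap.id
    simp only [charRep_apply, mul_one, LinearMap.id_coe, id_eq, charLie_apply] at hc1
    have e : (fun t : ℝ ↦ ℓ (RealMatrixGroup.twist G τ c (G.expMem (t • X)) v)) =
        fun t ↦ c (G.expMem (t • X)) * ℓ (τ (G.expMem (t • X)) v) := by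
      funext t
      rw [twist_apply, map_smul, smul_eq_mul]
    rw [e, twistLie_apply, map_add, map_smul, smul_eq_mul]
    have hprod := hc1.mul (h.hasDerivAt_coeff X v ℓ)
    have h0 : G.expMem ((0 : ℝ) • X) = 1 := by
      refine Subtype.ext (Units.ext ?_)
      simp only [coe_expMem, coe_expGL, zero_smul, ZeroMemClass.coe_zero, NormedSpace.exp_zero,
        Subgroup.coe_one, Units.val_one]
    rw [h0, map_one, map_one, one_mul, Module.End.one_apply] at hprod
    rw [add_comm]
    exact hprod

end IsDifferentiableRep

/-! #### The determinant character `det(φ(g))^m` -/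

section DetChar

open NormedSpace

variable (φ : A →ₐ[ℝ] ℂ) (m : ℤ)

/-- The character `g ↦ det(φ(g))^m` of `G ≤ GL(N, A)` for a real algebra morphism
`φ : A → ℂ` and `m ∈ ℤ`. [folklore] -/
def detChar (φ : A →ₐ[ℝ] ℂ) (m : ℤ) : G.carrier →* ℂ :=
  (Units.coeHom ℂ).comp ((zpowGroupHom m).comp (Matrix.GeneralLinearGroup.det.comp
    ((Matrix.GeneralLinearGroup.map (φ : A →+* ℂ)).comp G.carrier.subtype)))

/-- Unfolding: `det(φ(g))^m`. [folklore] -/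
theorem detChar_apply (g : G.carrier) :
    detChar G φ m g = (((g : GL N A) : Matrix N N A).map φ).det ^ m := by
  simp only [detChar, MonoidHom.comp_apply, Units.coeHom_apply, zpowGroupHom_apply,
    Units.val_zpow_eq_zpow_val]
  rfl

/-- `det(φ(g)) ≠ 0`. [folklore] -/
theorem det_map_ne_zero (g : G.carrier) : (((g : GL N A) : Matrix N N A).map φ).det ≠ 0 := by
  have h : (((g : GL N A) : Matrix N N A).map φ).det =
      ((Matrix.GeneralLinearGroup.det (Matrix.GeneralLinearGroup.map (φ : A →+* ℂ) (g : GL N A))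
        : ℂˣ) : ℂ) := rfl
  rw [h]
  exact Units.ne_zero _

/-- Its differential `X ↦ m · tr(φ(X))`, a morphism to the abelian Lie algebra `ℂ`. [folklore] -/
def detCharLie : G.lie →ₗ⁅ℝ⁆ ℂ :=
  { (m : ℂ) • ((Matrix.traceLinearMap N ℝ ℂ).comp
      ((φ.mapMatrix.toLinearMap).comp G.lie.incl.toLinearMap)) with
    map_lie' := by
      intro X Y
      change (m : ℂ) • Matrix.trace (φ.mapMatrix ((⁅X, Y⁆ : G.lie) : Matrix N N A)) =
        ⁅(m : ℂ) • Matrix.trace (φ.mapMatrix (X : Matrix N N A)),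
          (m : ℂ) • Matrix.trace (φ.mapMatrix (Y : Matrix N N A))⁆
      rw [LieRing.of_associative_ring_bracket, mul_comm, sub_self, LieSubalgebra.coe_bracket,
        LieRing.of_associative_ring_bracket, map_sub, map_mul, map_mul, Matrix.trace_sub,
        Matrix.trace_mul_comm, sub_self, smul_zero] }

/-- Unfolding. [folklore] -/
theorem detCharLie_apply (X : G.lie) :
    detCharLie G φ m X = (m : ℂ) * ((X : Matrix N N A).map φ).trace := rfl

/-- **The determinant character is differentiable**, with differential `m · tr ∘ φ`:
`det(φ(exp tX))^m = φ(det(exp tX))^m` and `d/dt det(exp tX)|₀ = tr X`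
(`Literature.Analysis.Matrix.hasDerivAt_det_exp_smul_zero`). [folklore] -/
theorem isDifferentiableRep_detChar (hφ : Continuous φ) :
    IsDifferentiableRep G (charRep G (detChar G φ m)) (charLie G (detCharLie G φ m)) where
  continuous_coeff z ℓ := by
    have e : (fun g : G.carrier ↦ ℓ (charRep G (detChar G φ m) g z)) =
        fun g : G.carrier ↦ (((g : GL N A) : Matrix N N A).map φ).det ^ m * ℓ z := by
      funext g
      rw [charRep_apply, ← smul_eq_mul, map_smul, smul_eq_mul, detChar_apply]
    rw [e]
    have hc : Continuous fun g : G.carrier ↦ (((g : GL N A) : Matrix N N A).map φ).det :=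
      ((Units.continuous_val.comp continuous_subtype_val).matrix_map hφ).matrix_det
    exact (hc.zpow₀ m fun g ↦ Or.inl (det_map_ne_zero G φ g)).mul continuous_const
  hasDerivAt_coeff X z ℓ := by
    have e : (fun t : ℝ ↦ ℓ (charRep G (detChar G φ m) (G.expMem (t • X)) z)) =
        fun t ↦ (φ (exp (t • (X : Matrix N N A))).det) ^ m * ℓ z := by
      funext t
      rw [charRep_apply, ← smul_eq_mul, map_smul, smul_eq_mul, detChar_apply, coe_expMem,
        coe_expGL, AlgHom.map_det]
      rfl
    rw [e, charLie_apply, ← smul_eq_mul, map_smul, smul_eq_mul, detCharLie_apply]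
    have hin : HasDerivAt (fun t : ℝ ↦ φ (exp (t • (X : Matrix N N A))).det)
        (φ (X : Matrix N N A).trace) 0 := by
      let Φ : A →L[ℝ] ℂ := ⟨φ.toLinearMap, hφ⟩
      exact Φ.hasFDerivAt.comp_hasDerivAt (0 : ℝ)
        (Literature.Analysis.Matrix.hasDerivAt_det_exp_smul_zero (X : Matrix N N A))
    have h1 : φ (exp ((0 : ℝ) • (X : Matrix N N A))).det = 1 := by
      rw [zero_smul, exp_zero, Matrix.det_one, map_one]
    have hz : HasDerivAt (fun w : ℂ ↦ w ^ m) (m : ℂ)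
        (φ (exp ((0 : ℝ) • (X : Matrix N N A))).det) := by
      rw [h1]
      have h := hasDerivAt_zpow m (1 : ℂ) (Or.inl one_ne_zero)
      rwa [one_zpow, mul_one] at h
    have hcomp := (hz.comp (0 : ℝ) hin).mul_const (ℓ z)
    rw [AddMonoidHom.map_trace φ] at hcomp
    exact hcomp

end DetChar

end RealMatrixGroup

end Literature.NumberTheory.Automorphic
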